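import Summits.ValiantsHypothesis.ValiantsHypothesis.Theorems.KPlusLogSqLawTropicalBNormalForm
import Summits.ValiantsHypothesis.ValiantsHypothesis.Theorems.KPlusLogSqLawWeakLiftingTowerGraftDissociated

/-!
# Route «KPlusLogSqLaw», crux `TropicalB` (stmt-ValiantsHypothesis-19771) — TROPICAL DISSOCIATION REDUCTION:
# the tropical census row `TropRootLawAt m K B` need only be proved for designs with `m`-DISSOCIATED exponents

HONEST FRAMING.  Def-free helper toward the registered regime stubs `stub_tropThin` / `stub_tropFat` (each ⟺ the crux) of
`Cruxes/TropicalB/Lines/birth.lean` (crux `Summit.ValiantsHypothesis.ValiantsHypothesis.Theses.KPlusLogSqLaw.TropicalB`, item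
stmt-ValiantsHypothesis-19771, route KPlusLogSqLaw; hand `leafhand-val-kpluslogsqlaw-1` g0, 2026-08-31, `--supports … --as helper`).
A NORMAL FORM (w.l.o.g.) for the OPEN crux; nothing here bounds `T(m, K)` inside the window `log₂ m + 1 < K < m`, and nothing bears on
`TropicalB`, `WeakLifting` (stmt-19561), `Lifting` (stmt-19772), `MatrixDescartes` (stmt-18050) or VP ≠ VNP.

The exponent map `d : Fin K → ℕ` of a design is `m`-DISSOCIATED if distinct class-count vectors `n : Fin K → ℕ` of total `m` have distinct
slopes `Σ n l · d l` (the WeakLifting line's `IsDissociated`, `Cruxes/WeakLifting/Lines/tower_graft.lean`; spelled inline here, exactly as in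
`…WeakLiftingTowerGraftDissociated`).  On a dissociated support every linear piece of the upper envelope
`θ ↦ max_p tropWeight d v θ p` belongs to ONE class-count vector, and two present terms have equal slope iff they have the same class
multiset.  The tree's normal forms so far make `d` injective / strictly increasing with least exponent `0` (`…TropicalBMergeClasses`,
`…TropicalBNormalForm`) and the valuations generic (`…TropicalBGenericPerturbation`); this file makes the EXPONENTS generic:

* `sumE_nonneg`, `sumE_le` — the tie-breaker sum `Σ_b e(λ b)` of a term lies in `[0, m·E]` when `e ≤ E`;
* `tropWeight_blowup` — under the blow-up `d ↦ N·d + e`, `v ↦ N·v` every weight becomes `N·(old weight) + θ·Σ_b e(λ b)`;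
* `isDominant_blowup` — hence a term dominant at an integer slope `θ` stays dominant at `θ` as soon as `N > |θ|·m·E` (the integer margin
  `≥ 1` of the old design becomes `≥ N`, which beats the tie-breaker discrepancy `≤ |θ|·m·E`); signs are untouched (same `ε`);
* `chain_blowup` — so every sign-alternating dominant chain of `(d, v, ε)` is, at the SAME slopes, with the same terms and signs, a
  sign-alternating dominant chain of `(N·d + e, N·v, ε)` for every `N > (max_k |θ_k|)·m·E`;
* `tropRootLawAt_of_dissociated`, `tropRootLawAt_iff_dissociated` — **`TropRootLawAt m K B` holds as soon as it holds for all designs whose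
  exponent map is `m`-dissociated** (take `e l = (m+1)^l`, the tower tie-breaker, dissociated by `TowerGraft.tower_tieBreaker_dissociated`, and
  `N` past both thresholds; the blown-up support is dissociated by `TowerGraft.blowup_dissociated` — both tree lemmas used BY NAME);
* `tropKPlusLogSqLaw_iff_dissociated` — the same for TB (`TropKPlusLogSqLaw`, δ-equal to the crux `TropicalB`);
* §4 `digit_lt_iff`, `sumE_lt`, `blowupSlope_lt_iff` — THE ORDER OF THE BLOWN-UP SLOPES (rev 2): for `N > m·E` the total exponent of a term
  under `N·d + e` is `N·(old total exponent) + Σ_b e(λ b)` with remainder `< N`, so blown-up slopes compare LEXICOGRAPHICALLY — old slope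
  first, tie-breaker sum second (with `e l = (m+1)^l` the tie-breaker sum is the base-`(m+1)` value of the class-count vector, i.e. ties of
  the old slope are broken by the LEX order of the count vectors, highest class most significant); this is the «odometer reading» that
  `…TropicalBScaleSeparation` has only for super-increasing exponents, now available inside every old slope fibre of an arbitrary design;
* §5 `tropRootLawAtStatic_of_dissociated`, `tropRootLawAtStatic_iff_dissociated` — the same reduction for the STATIC row
  `TropRootLawAtStatic` of `…CensusTropicalKLawStatic` (the canonical dress of the crux, `stub_tropStaticDiagonal`): the blow-up keeps
  `ε`, hence `IsStatic ε`;
* §6 `tropRootLawAt_of_normalDissociated`, `tropKPlusLogSqLaw_iff_normalDissociated` — THE COMBINED NORMAL FORM (rev 3): a row law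
  monotone in `K` (resp. TB) need only be proved for designs whose exponent map is STRICTLY INCREASING, has LEAST EXPONENT `0`, AND is
  `m`-DISSOCIATED — first `…TropicalBNormalForm.tropRootLawAt_of_strictMono` (merge / sort / translate), then the blow-up
  `l ↦ N·d l + (m+1)^l − 1` of this file (strictly increasing, value `0` at the bottom class, dissociated; dominance transfers by `chain_blowup`
  and `…TropicalBNormalForm.isDominant_translate_iff`).

So every attack on the window may assume that ALL `C(m+K−1, m)` class-count vectors have pairwise distinct slopes and, at the same time,
that `d` is strictly increasing from `d₀ = 0` (§6).  The real-side twin is the line's (L1) `TowerGraft.dissociation_reduction`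
(analytic: roots survive `u ↦ u^{1/N}`); the tropical side is exact and elementary. [folklore: perturbation of the objective of a parametric
assignment problem into general position by a large scaling plus a dissociated tie-breaker]
-/

-- `Summit.ValiantsHypothesis.ValiantsHypothesis.…` repeats a component by the D-0017 layout (single-conjunct summit),
-- which the `dupNamespace` linter flags; the namespace is mandated (same as the sibling `…TropicalB*` modules).
set_option linter.dupNamespace false
set_option autoImplicit false

namespace Summit.ValiantsHypothesis.ValiantsHypothesis.Theorems.KPlusLogSqLaw

namespace TropicalDissociation

open Summit.ValiantsHypothesis.ValiantsHypothesis.Theorems.MatrixDescartes.Negative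
open Summit.ValiantsHypothesis.ValiantsHypothesis.Theorems.LacunarySymmetroidMatrixDescartes.TropicalCensus
open scoped BigOperators
open Finset

variable {m K : ℕ}

/-! ## 1. The tie-breaker sum of a term -/

/-- the tie-breaker sum `Σ_b e(λ b)` of a term is nonnegative. [folklore] -/
theorem sumE_nonneg (e : Fin K → ℕ) (q : Equiv.Perm (Fin m) × (Fin m → Fin K)) :
    (0 : ℤ) ≤ ∑ i, (e (q.2 i) : ℤ) :=
  Finset.sum_nonneg fun _ _ => Int.natCast_nonneg _

/-- the tie-breaker sum `Σ_b e(λ b)` of a term is at most `m·E` when `e ≤ E`. [folklore] -/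
theorem sumE_le {E : ℕ} (e : Fin K → ℕ) (he : ∀ l, e l ≤ E) (q : Equiv.Perm (Fin m) × (Fin m → Fin K)) :
    ∑ i, (e (q.2 i) : ℤ) ≤ (m : ℤ) * E := by
  calc ∑ i, (e (q.2 i) : ℤ) ≤ ∑ _i : Fin m, (E : ℤ) := Finset.sum_le_sum fun i _ => by exact_mod_cast he (q.2 i)
    _ = (m : ℤ) * E := by simp

/-! ## 2. Weights and dominance under the exponent blow-up `d ↦ N·d + e`, `v ↦ N·v` -/

/-- **weights under the blow-up**: `tropWeight (N·d + e) (N·v) θ q = N · tropWeight d v θ q + θ · Σ_b e(λ b)`. [folklore] -/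
theorem tropWeight_blowup (N : ℕ) (d e : Fin K → ℕ) (v : Fin m → Fin m → Fin K → ℤ) (θ : ℤ)
    (q : Equiv.Perm (Fin m) × (Fin m → Fin K)) :
    tropWeight (fun l => N * d l + e l) (fun a b l => (N : ℤ) * v a b l) θ q =
      (N : ℤ) * tropWeight d v θ q + θ * ∑ i, (e (q.2 i) : ℤ) := by
  unfold tropWeight
  simp only [Nat.cast_add, Nat.cast_mul, Finset.sum_add_distrib, ← Finset.mul_sum]
  ring

/-- **dominance survives the blow-up** at the same integer slope `θ` once `N > |θ|·m·E` (`e ≤ E`): the old integer margin `≥ 1`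
becomes `≥ N`, the tie-breaker discrepancy is at most `|θ|·m·E`. [folklore] -/
theorem isDominant_blowup {N E : ℕ} (d e : Fin K → ℕ) (v ε : Fin m → Fin m → Fin K → ℤ) (θ : ℤ)
    (p : Equiv.Perm (Fin m) × (Fin m → Fin K)) (he : ∀ l, e l ≤ E) (hN : θ.natAbs * (m * E) < N)
    (hp : IsDominant d v ε θ p) :
    IsDominant (fun l => N * d l + e l) (fun a b l => (N : ℤ) * v a b l) ε θ p := by
  refine ⟨hp.1, fun q hq hq0 => ?_⟩
  have h1 : tropWeight d v θ q < tropWeight d v θ p := hp.2 q hq hq0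
  rw [tropWeight_blowup, tropWeight_blowup]
  set Sq := ∑ i, (e (q.2 i) : ℤ) with hSq
  set Sp := ∑ i, (e (p.2 i) : ℤ) with hSp
  have hq0' : (0 : ℤ) ≤ Sq := sumE_nonneg e q
  have hp0' : (0 : ℤ) ≤ Sp := sumE_nonneg e p
  have hqE : Sq ≤ (m : ℤ) * E := sumE_le e he q
  have hpE : Sp ≤ (m : ℤ) * E := sumE_le e he p
  have hdiff : |Sq - Sp| ≤ (m : ℤ) * E := by
    rw [abs_le]; constructor <;> linarith
  have hN' : |θ| * ((m : ℤ) * E) < N := by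
    have := hN
    rw [← Int.natCast_natAbs]
    exact_mod_cast this
  have hkey : θ * Sq - θ * Sp ≤ |θ| * ((m : ℤ) * E) := by
    calc θ * Sq - θ * Sp = θ * (Sq - Sp) := by ring
      _ ≤ |θ * (Sq - Sp)| := le_abs_self _
      _ = |θ| * |Sq - Sp| := abs_mul _ _
      _ ≤ |θ| * ((m : ℤ) * E) := mul_le_mul_of_nonneg_left hdiff (abs_nonneg θ)
  have hmargin : (N : ℤ) ≤ (N : ℤ) * (tropWeight d v θ p - tropWeight d v θ q) :=
    le_mul_of_one_le_right (Int.natCast_nonneg N) (by linarith)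
  nlinarith

/-- **chains survive the blow-up**: a chain of terms dominant at slopes `θ_k` with `|θ_k| ≤ T` is dominant at the same slopes for
the blown-up design whenever `N > T·m·E`. [folklore] -/
theorem chain_blowup {N E T n : ℕ} (d e : Fin K → ℕ) (v ε : Fin m → Fin m → Fin K → ℤ) (θ : Fin (n + 1) → ℤ)
    (p : Fin (n + 1) → Equiv.Perm (Fin m) × (Fin m → Fin K)) (he : ∀ l, e l ≤ E) (hT : ∀ k, (θ k).natAbs ≤ T)
    (hN : T * (m * E) < N) (hdom : ∀ k, IsDominant d v ε (θ k) (p k)) :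
    ∀ k, IsDominant (fun l => N * d l + e l) (fun a b l => (N : ℤ) * v a b l) ε (θ k) (p k) :=
  fun k => isDominant_blowup d e v ε (θ k) (p k) he (lt_of_le_of_lt (Nat.mul_le_mul_right _ (hT k)) hN) (hdom k)

/-! ## 3. The reduction -/

/-- **TROPICAL DISSOCIATION REDUCTION.**  If every design of format `(m, K)` whose exponent map is `m`-dissociated (distinct class-count
vectors of total `m` have distinct slopes) has at most `B` sign-alternating dominant breakpoints, then so does EVERY design of format
`(m, K)`: blow the exponents up to `N·d + (m+1)^l` (dissociated by `TowerGraft.blowup_dissociated` + `TowerGraft.tower_tieBreaker_dissociated`)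
and the valuations to `N·v`, with `N` past `m·(m+1)^K` and past `(max_k |θ_k|)·m·(m+1)^K`; the chain transfers verbatim (`chain_blowup`).
[folklore] -/
theorem tropRootLawAt_of_dissociated {B : ℕ}
    (h : ∀ (d : Fin K → ℕ),
      (∀ n n' : Fin K → ℕ, ∑ l, n l = m → ∑ l, n' l = m → ∑ l, n l * d l = ∑ l, n' l * d l → n = n') →
      ∀ (v ε : Fin m → Fin m → Fin K → ℤ) (n : ℕ) (θ : Fin (n + 1) → ℤ)
        (p : Fin (n + 1) → Equiv.Perm (Fin m) × (Fin m → Fin K)),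
        (∀ i j l, (ε i j l).natAbs ≤ 1) → StrictMono θ → (∀ k, IsDominant d v ε (θ k) (p k)) →
        (∀ k : Fin n, termSign ε (p k.castSucc) * termSign ε (p k.succ) < 0) → n ≤ B) :
    TropRootLawAt m K B := by
  intro d v ε n θ p hε hθ hdom halt
  -- the tower tie-breaker `e l = (m+1)^l ≤ E = (m+1)^K`, the slope window `T = max |θ_k|`, and the scale `N`
  set e : Fin K → ℕ := fun l => (m + 1) ^ (l : ℕ) with he_def
  set E : ℕ := (m + 1) ^ K with hE_def
  have he : ∀ l, e l ≤ E := fun l => Nat.pow_le_pow_right (Nat.succ_pos m) l.isLt.le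
  set T : ℕ := Finset.univ.sup fun k => (θ k).natAbs with hT_def
  have hT : ∀ k, (θ k).natAbs ≤ T := fun k => Finset.le_sup (f := fun k => (θ k).natAbs) (Finset.mem_univ k)
  set N : ℕ := T * (m * E) + m * E + 1 with hN_def
  have hN1 : T * (m * E) < N := by omega
  have hN2 : ∀ l, m * e l < N := fun l => by
    have : m * e l ≤ m * E := Nat.mul_le_mul_left m (he l)
    omega
  have hdis : ∀ n n' : Fin K → ℕ, ∑ l, n l = m → ∑ l, n' l = m →
      ∑ l, n l * (N * d l + e l) = ∑ l, n' l * (N * d l + e l) → n = n' :=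
    TowerGraft.blowup_dissociated m K N d e (TowerGraft.tower_tieBreaker_dissociated m K) hN2
  exact h (fun l => N * d l + e l) hdis (fun a b l => (N : ℤ) * v a b l) ε n θ p hε hθ
    (chain_blowup d e v ε θ p he hT hN1 hdom) halt

/-- the reduction as an equivalence (the converse is the restriction to dissociated supports). [folklore] -/
theorem tropRootLawAt_iff_dissociated (m K B : ℕ) :
    TropRootLawAt m K B ↔
      ∀ (d : Fin K → ℕ),
        (∀ n n' : Fin K → ℕ, ∑ l, n l = m → ∑ l, n' l = m → ∑ l, n l * d l = ∑ l, n' l * d l → n = n') →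
        ∀ (v ε : Fin m → Fin m → Fin K → ℤ) (n : ℕ) (θ : Fin (n + 1) → ℤ)
          (p : Fin (n + 1) → Equiv.Perm (Fin m) × (Fin m → Fin K)),
          (∀ i j l, (ε i j l).natAbs ≤ 1) → StrictMono θ → (∀ k, IsDominant d v ε (θ k) (p k)) →
          (∀ k : Fin n, termSign ε (p k.castSucc) * termSign ε (p k.succ) < 0) → n ≤ B :=
  ⟨fun h d _ => h d, tropRootLawAt_of_dissociated⟩

/-- **TB need only be proved on dissociated supports** (`TropKPlusLogSqLaw` is δ-equal to the crux `TropicalB`). [folklore] -/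
theorem tropKPlusLogSqLaw_iff_dissociated :
    TropKPlusLogSqLaw ↔
      ∃ C : ℕ, ∀ (m K : ℕ) (d : Fin K → ℕ),
        (∀ n n' : Fin K → ℕ, ∑ l, n l = m → ∑ l, n' l = m → ∑ l, n l * d l = ∑ l, n' l * d l → n = n') →
        ∀ (v ε : Fin m → Fin m → Fin K → ℤ) (n : ℕ) (θ : Fin (n + 1) → ℤ)
          (p : Fin (n + 1) → Equiv.Perm (Fin m) × (Fin m → Fin K)),
          (∀ i j l, (ε i j l).natAbs ≤ 1) → StrictMono θ → (∀ k, IsDominant d v ε (θ k) (p k)) →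
          (∀ k : Fin n, termSign ε (p k.castSucc) * termSign ε (p k.succ) < 0) → n ≤ 2 ^ (C * (K + Nat.log 2 m ^ 2)) := by
  constructor
  · rintro ⟨C, hC⟩
    exact ⟨C, fun m K d _ => hC m K d⟩
  · rintro ⟨C, hC⟩
    exact ⟨C, fun m K => tropRootLawAt_of_dissociated (hC m K)⟩

/-! ## 4. The order of the blown-up slopes: old slope first, tie-breaker sum second (rev 2) -/

/-- digit comparison: for remainders `r, r' < N`, `N·A + r < N·A' + r'` iff `A < A'`, or `A = A'` and `r < r'`. [folklore] -/
theorem digit_lt_iff {N A A' r r' : ℕ} (hr : r < N) (hr' : r' < N) :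
    N * A + r < N * A' + r' ↔ A < A' ∨ (A = A' ∧ r < r') := by
  constructor
  · intro h
    rcases lt_trichotomy A A' with hA | hA | hA
    · exact Or.inl hA
    · subst hA; exact Or.inr ⟨rfl, by omega⟩
    · exfalso
      have h1 : N * A' + N ≤ N * A := by
        have : N * (A' + 1) ≤ N * A := Nat.mul_le_mul_left N hA
        rw [Nat.mul_succ] at this; exact this
      omega
  · rintro (hA | ⟨rfl, hrr⟩)
    · have h1 : N * A + N ≤ N * A' := by
        have : N * (A + 1) ≤ N * A' := Nat.mul_le_mul_left N hA
        rw [Nat.mul_succ] at this; exact this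
      omega
    · omega

/-- the tie-breaker sum of a term is below `N` once `m·E < N` (`e ≤ E`). [folklore] -/
theorem sumE_lt {N E : ℕ} (e : Fin K → ℕ) (he : ∀ l, e l ≤ E) (hN : m * E < N) (q : Equiv.Perm (Fin m) × (Fin m → Fin K)) :
    ∑ i, e (q.2 i) < N := by
  refine lt_of_le_of_lt ?_ hN
  calc ∑ i, e (q.2 i) ≤ ∑ _i : Fin m, E := Finset.sum_le_sum fun i _ => he (q.2 i)
    _ = m * E := by simp

/-- **the blown-up slopes compare lexicographically**: for `N > m·E` the total exponent of a term under `N·d + e` is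
`N·(old total exponent) + (tie-breaker sum)` with tie-breaker sum `< N`, so for two terms `q, q'` the blown-up slope of `q` is smaller
iff the old slope is smaller, or the old slopes agree and the tie-breaker sum is smaller.  With `e l = (m+1)^l` the tie-breaker sum is the
base-`(m+1)` value of the class-count vector: old-slope ties are broken by the LEX order of the count vectors. [folklore] -/
theorem blowupSlope_lt_iff {N E : ℕ} (d e : Fin K → ℕ) (he : ∀ l, e l ≤ E) (hN : m * E < N)
    (q q' : Equiv.Perm (Fin m) × (Fin m → Fin K)) :
    ∑ i, (N * d (q.2 i) + e (q.2 i)) < ∑ i, (N * d (q'.2 i) + e (q'.2 i)) ↔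
      ∑ i, d (q.2 i) < ∑ i, d (q'.2 i) ∨
        (∑ i, d (q.2 i) = ∑ i, d (q'.2 i) ∧ ∑ i, e (q.2 i) < ∑ i, e (q'.2 i)) := by
  have split : ∀ r : Equiv.Perm (Fin m) × (Fin m → Fin K),
      ∑ i, (N * d (r.2 i) + e (r.2 i)) = N * ∑ i, d (r.2 i) + ∑ i, e (r.2 i) := by
    intro r
    rw [Finset.sum_add_distrib, Finset.mul_sum]
  rw [split q, split q']
  exact digit_lt_iff (sumE_lt e he hN q) (sumE_lt e he hN q')

/-! ## 5. The same reduction for the STATIC row (the canonical dress of the crux) -/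

/-- **STATIC TROPICAL DISSOCIATION REDUCTION.**  `TropRootLawAtStatic m K B` (static designs: at most one present class per entry) holds as
soon as it holds for static designs with `m`-dissociated exponents — the blow-up keeps the sign pattern `ε`, hence `IsStatic ε`. [folklore] -/
theorem tropRootLawAtStatic_of_dissociated {B : ℕ}
    (h : ∀ (d : Fin K → ℕ),
      (∀ n n' : Fin K → ℕ, ∑ l, n l = m → ∑ l, n' l = m → ∑ l, n l * d l = ∑ l, n' l * d l → n = n') →
      ∀ (v ε : Fin m → Fin m → Fin K → ℤ) (n : ℕ) (θ : Fin (n + 1) → ℤ)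
        (p : Fin (n + 1) → Equiv.Perm (Fin m) × (Fin m → Fin K)),
        (∀ i j l, (ε i j l).natAbs ≤ 1) → IsStatic ε → StrictMono θ → (∀ k, IsDominant d v ε (θ k) (p k)) →
        (∀ k : Fin n, termSign ε (p k.castSucc) * termSign ε (p k.succ) < 0) → n ≤ B) :
    TropRootLawAtStatic m K B := by
  intro d v ε n θ p hε hst hθ hdom halt
  set e : Fin K → ℕ := fun l => (m + 1) ^ (l : ℕ) with he_def
  set E : ℕ := (m + 1) ^ K with hE_def
  have he : ∀ l, e l ≤ E := fun l => Nat.pow_le_pow_right (Nat.succ_pos m) l.isLt.le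
  set T : ℕ := Finset.univ.sup fun k => (θ k).natAbs with hT_def
  have hT : ∀ k, (θ k).natAbs ≤ T := fun k => Finset.le_sup (f := fun k => (θ k).natAbs) (Finset.mem_univ k)
  set N : ℕ := T * (m * E) + m * E + 1 with hN_def
  have hN1 : T * (m * E) < N := by omega
  have hN2 : ∀ l, m * e l < N := fun l => by
    have : m * e l ≤ m * E := Nat.mul_le_mul_left m (he l)
    omega
  have hdis : ∀ n n' : Fin K → ℕ, ∑ l, n l = m → ∑ l, n' l = m →
      ∑ l, n l * (N * d l + e l) = ∑ l, n' l * (N * d l + e l) → n = n' :=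
    TowerGraft.blowup_dissociated m K N d e (TowerGraft.tower_tieBreaker_dissociated m K) hN2
  exact h (fun l => N * d l + e l) hdis (fun a b l => (N : ℤ) * v a b l) ε n θ p hε hst hθ
    (chain_blowup d e v ε θ p he hT hN1 hdom) halt

/-- the static reduction as an equivalence. [folklore] -/
theorem tropRootLawAtStatic_iff_dissociated (m K B : ℕ) :
    TropRootLawAtStatic m K B ↔
      ∀ (d : Fin K → ℕ),
        (∀ n n' : Fin K → ℕ, ∑ l, n l = m → ∑ l, n' l = m → ∑ l, n l * d l = ∑ l, n' l * d l → n = n') →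
        ∀ (v ε : Fin m → Fin m → Fin K → ℤ) (n : ℕ) (θ : Fin (n + 1) → ℤ)
          (p : Fin (n + 1) → Equiv.Perm (Fin m) × (Fin m → Fin K)),
          (∀ i j l, (ε i j l).natAbs ≤ 1) → IsStatic ε → StrictMono θ → (∀ k, IsDominant d v ε (θ k) (p k)) →
          (∀ k : Fin n, termSign ε (p k.castSucc) * termSign ε (p k.succ) < 0) → n ≤ B :=
  ⟨fun h d _ => h d, tropRootLawAtStatic_of_dissociated⟩

/-! ## 6. The combined normal form: strictly increasing from `0` AND dissociated (rev 3) -/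

/-- the shifted blow-up `l ↦ N·d l + (m+1)^l − 1` of a strictly increasing exponent map with `d₀ = 0` (and `N ≥ 1`) is strictly
increasing, vanishes at the bottom class, and adding `1` back gives the plain blow-up `N·d + (m+1)^l`. [folklore] -/
theorem shiftedBlowup_normal {N : ℕ} (hN : 0 < N) (d : Fin K → ℕ) (hd : StrictMono d) (hz : ∀ h : 0 < K, d ⟨0, h⟩ = 0) :
    StrictMono (fun l : Fin K => N * d l + (m + 1) ^ (l : ℕ) - 1) ∧
      (∀ h : 0 < K, (fun l : Fin K => N * d l + (m + 1) ^ (l : ℕ) - 1) ⟨0, h⟩ = 0) ∧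
      (fun l : Fin K => (N * d l + (m + 1) ^ (l : ℕ) - 1) + 1) = fun l => N * d l + (m + 1) ^ (l : ℕ) := by
  have h1 : ∀ l : Fin K, 1 ≤ (m + 1) ^ (l : ℕ) := fun l => Nat.one_le_pow _ _ (Nat.succ_pos m)
  refine ⟨fun l l' hll' => ?_, fun h => ?_, funext fun l => ?_⟩
  · have h2 : N * d l < N * d l' := Nat.mul_lt_mul_of_pos_left (hd hll') hN
    have h3 : (m + 1) ^ (l : ℕ) ≤ (m + 1) ^ (l' : ℕ) := Nat.pow_le_pow_right (Nat.succ_pos m) (Fin.le_iff_val_le_val.mp hll'.le)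
    have h4 := h1 l
    show N * d l + (m + 1) ^ (l : ℕ) - 1 < N * d l' + (m + 1) ^ (l' : ℕ) - 1
    omega
  · show N * d ⟨0, h⟩ + (m + 1) ^ ((⟨0, h⟩ : Fin K) : ℕ) - 1 = 0
    rw [hz h]; simp
  · have h4 := h1 l
    omega

/-- dissociation of the shifted blow-up: if `l ↦ D l + 1` is `m`-dissociated then so is `D` (class-count vectors of total `m`:
`Σ n (D + 1) = Σ n D + m`). [folklore] -/
theorem dissociated_of_dissociated_succ (D : Fin K → ℕ)
    (h : ∀ n n' : Fin K → ℕ, ∑ l, n l = m → ∑ l, n' l = m → ∑ l, n l * (D l + 1) = ∑ l, n' l * (D l + 1) → n = n') :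
    ∀ n n' : Fin K → ℕ, ∑ l, n l = m → ∑ l, n' l = m → ∑ l, n l * D l = ∑ l, n' l * D l → n = n' := by
  intro n n' hn hn' hsum
  refine h n n' hn hn' ?_
  have split : ∀ f : Fin K → ℕ, ∑ l, f l * (D l + 1) = ∑ l, f l * D l + ∑ l, f l := by
    intro f
    rw [← Finset.sum_add_distrib]
    exact Finset.sum_congr rfl fun l _ => by ring
  rw [split n, split n', hsum, hn, hn']

/-- **THE COMBINED NORMAL FORM.**  A row law `F m K` monotone in `K` holds at every format as soon as it holds for designs whose exponent map
is strictly increasing, vanishes at the bottom class, and is `m`-dissociated: normalise by `…TropicalBNormalForm` (merge equal exponents, sort,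
translate to `d₀ = 0`), then blow up to `N·d + (m+1)^l − 1`. [folklore] -/
theorem tropRootLawAt_of_normalDissociated (F : ℕ → ℕ → ℕ) (hF : ∀ m, Monotone (F m))
    (h : ∀ (m K : ℕ) (d : Fin K → ℕ), StrictMono d → (∀ h : 0 < K, d ⟨0, h⟩ = 0) →
      (∀ n n' : Fin K → ℕ, ∑ l, n l = m → ∑ l, n' l = m → ∑ l, n l * d l = ∑ l, n' l * d l → n = n') →
      ∀ (v ε : Fin m → Fin m → Fin K → ℤ) (n : ℕ) (θ : Fin (n + 1) → ℤ)
        (p : Fin (n + 1) → Equiv.Perm (Fin m) × (Fin m → Fin K)),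
        (∀ i j l, (ε i j l).natAbs ≤ 1) → StrictMono θ → (∀ k, IsDominant d v ε (θ k) (p k)) →
        (∀ k : Fin n, termSign ε (p k.castSucc) * termSign ε (p k.succ) < 0) → n ≤ F m K)
    (m K : ℕ) : TropRootLawAt m K (F m K) := by
  refine tropRootLawAt_of_strictMono F hF (fun m K d hd hz v ε n θ p hε hθ hdom halt => ?_) m K
  -- blow up the normalised design
  set e : Fin K → ℕ := fun l => (m + 1) ^ (l : ℕ) with he_def
  set E : ℕ := (m + 1) ^ K with hE_def
  have he : ∀ l, e l ≤ E := fun l => Nat.pow_le_pow_right (Nat.succ_pos m) l.isLt.le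
  set T : ℕ := Finset.univ.sup fun k => (θ k).natAbs with hT_def
  have hT : ∀ k, (θ k).natAbs ≤ T := fun k => Finset.le_sup (f := fun k => (θ k).natAbs) (Finset.mem_univ k)
  set N : ℕ := T * (m * E) + m * E + 1 with hN_def
  have hNpos : 0 < N := by omega
  have hN1 : T * (m * E) < N := by omega
  have hN2 : ∀ l, m * e l < N := fun l => by
    have : m * e l ≤ m * E := Nat.mul_le_mul_left m (he l)
    omega
  have hdis : ∀ n n' : Fin K → ℕ, ∑ l, n l = m → ∑ l, n' l = m →
      ∑ l, n l * (N * d l + e l) = ∑ l, n' l * (N * d l + e l) → n = n' :=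
    TowerGraft.blowup_dissociated m K N d e (TowerGraft.tower_tieBreaker_dissociated m K) hN2
  have hdom' : ∀ k, IsDominant (fun l => N * d l + e l) (fun a b l => (N : ℤ) * v a b l) ε (θ k) (p k) :=
    chain_blowup d e v ε θ p he hT hN1 hdom
  -- shift down by one
  obtain ⟨hsm, hz', hfun⟩ := shiftedBlowup_normal (m := m) hNpos d hd hz
  set D : Fin K → ℕ := fun l => N * d l + (m + 1) ^ (l : ℕ) - 1 with hD_def
  have hfun' : (fun l : Fin K => D l + 1) = fun l => N * d l + e l := hfun
  have hpt : ∀ l, D l + 1 = N * d l + e l := fun l => congrFun hfun' l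
  have hdisD : ∀ n n' : Fin K → ℕ, ∑ l, n l = m → ∑ l, n' l = m →
      ∑ l, n l * D l = ∑ l, n' l * D l → n = n' := by
    refine dissociated_of_dissociated_succ D fun n n' hn hn' hsum => hdis n n' hn hn' ?_
    simpa only [hpt] using hsum
  have hdomD : ∀ k, IsDominant D (fun a b l => (N : ℤ) * v a b l) ε (θ k) (p k) := fun k => by
    rw [← isDominant_translate_iff D 1, hfun']; exact hdom' k
  exact h m K D hsm hz' hdisD (fun a b l => (N : ℤ) * v a b l) ε n θ p hε hθ hdomD halt

/-- **TB in the combined normal form**: `TropKPlusLogSqLaw` (≡ the crux `TropicalB`) is equivalent to its restriction to designs with strictly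
increasing, `m`-dissociated exponents vanishing at the bottom class. [folklore] -/
theorem tropKPlusLogSqLaw_iff_normalDissociated :
    TropKPlusLogSqLaw ↔
      ∃ C : ℕ, ∀ (m K : ℕ) (d : Fin K → ℕ), StrictMono d → (∀ h : 0 < K, d ⟨0, h⟩ = 0) →
        (∀ n n' : Fin K → ℕ, ∑ l, n l = m → ∑ l, n' l = m → ∑ l, n l * d l = ∑ l, n' l * d l → n = n') →
        ∀ (v ε : Fin m → Fin m → Fin K → ℤ) (n : ℕ) (θ : Fin (n + 1) → ℤ)
          (p : Fin (n + 1) → Equiv.Perm (Fin m) × (Fin m → Fin K)),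
          (∀ i j l, (ε i j l).natAbs ≤ 1) → StrictMono θ → (∀ k, IsDominant d v ε (θ k) (p k)) →
          (∀ k : Fin n, termSign ε (p k.castSucc) * termSign ε (p k.succ) < 0) → n ≤ 2 ^ (C * (K + Nat.log 2 m ^ 2)) := by
  constructor
  · rintro ⟨C, hC⟩
    exact ⟨C, fun m K d _ _ _ => hC m K d⟩
  · rintro ⟨C, hC⟩
    refine ⟨C, fun m K => ?_⟩
    refine tropRootLawAt_of_normalDissociated (fun m K => 2 ^ (C * (K + Nat.log 2 m ^ 2))) (fun m => ?_) hC m K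
    intro K K' hKK'
    exact Nat.pow_le_pow_right (by norm_num) (Nat.mul_le_mul_left C (by omega))

end TropicalDissociation

end Summit.ValiantsHypothesis.ValiantsHypothesis.Theorems.KPlusLogSqLaw
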